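import Summits.BirchSwinnertonDyer.BirchSwinnertonDyer.Theorems.ResidualThetaTransportAtTwoHeckeThetaPartnerAdicAtTwoUnitCharacterPrelim
import Literature.NumberTheory.LFunctions.IdealNormCount
import Mathlib.RingTheory.ClassGroup.Basic
import Mathlib.NumberTheory.NumberField.Units.Basic
import Mathlib.NumberTheory.NumberField.ClassNumber
import HarnessLib

/-!
# Counting lattice points of given norm over ideal-class representatives (toward K0⁺, stmt-20690)

Route `ResidualThetaTransportAtTwo`, crux K0⁺ `HeckeThetaPartnerAdicAtTwo` (stmt-BirchSwinnertonDyer-20690),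
line "Hecke theta series from the genus-two Riemann theta function".  THEOREMS ONLY.

For an imaginary quadratic field `K` with `w = #𝓞_K^×` and a system `(𝔞_c)_{c ∈ Cl(K)}` of
nonzero integral representatives of the ideal classes, the classical count behind
"`Σ_c θ_{𝔞_c}(τ) = h + w Σ_{n ≥ 1} a_K(n) qⁿ`" (Hecke 1926 §2; Cox, *Primes of the form x² + ny²*,
Thm. 7.7 and (7.16); Zagier, *Zetafunktionen und quadratische Körper* §8):

* `finite_units` — `𝓞_K^×` is finite (every unit has absolute value `1` under the complex
  embedding, tree `HeckeThetaPartner.norm_embedding_unit_eq_one`, hence is torsion);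
* `natCard_generators_eq` — a nonzero principal ideal has exactly `w` generators;
* **`sum_natCard_norm_eq`** — for `n ≥ 1`:
  `Σ_c #{x ∈ 𝔞_c : N((x)) = n · N𝔞_c} = w · #{𝔟 ⊆ 𝓞_K : N𝔟 = n}` (`idealNormCount K n`), via
  `x ↦ 𝔟 = (x)𝔞_c⁻¹`, whose fibres are the generator sets of the principal ideals `𝔞_c 𝔟`.

BSD is not proved by this file.
-/

set_option autoImplicit false
set_option linter.dupNamespace false

noncomputable section

open scoped NumberField nonZeroDivisors
open NumberField Module Ideal

namespace Summit.BirchSwinnertonDyer.BirchSwinnertonDyer.Theorems.HeckeTheta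

open Summit.BirchSwinnertonDyer.BirchSwinnertonDyer.Theorems.HeckeThetaPartner
open Literature.NumberTheory.LFunctions (idealNormCount)

variable {K : Type} [Field K] [NumberField K]

/-! ### Units -/

/-- The unit group of an imaginary quadratic field is finite: every unit has absolute value `1`
under the complex embedding (tree `norm_embedding_unit_eq_one`), hence is torsion
(`NumberField.Units.mem_torsion`). -/
theorem finite_units (hK : finrank ℚ K = 2) [IsTotallyComplex K] : Finite (𝓞 K)ˣ := by
  have hall : ∀ u : (𝓞 K)ˣ, u ∈ NumberField.Units.torsion K := by
    intro u
    rw [NumberField.Units.mem_torsion]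
    intro w
    rw [← w.norm_embedding_eq]
    exact norm_embedding_unit_eq_one hK w.embedding u
  have hf : Function.Injective (fun u : (𝓞 K)ˣ => (⟨u, hall u⟩ : NumberField.Units.torsion K)) :=
    fun u v h => by simpa using congrArg Subtype.val h
  exact Finite.of_injective _ hf

omit [NumberField K] in
/-- **A nonzero principal ideal `(x₀)` has exactly `#𝓞_K^×` generators**: `(x) = (x₀) ⟺ x = u x₀`
with `u` a unit (`Ideal.span_singleton_eq_span_singleton`), and `u ↦ u x₀` is injective. -/
theorem natCard_generators_eq {x₀ : 𝓞 K} (hx₀ : x₀ ≠ 0) :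
    Nat.card {x : 𝓞 K // Ideal.span {x} = Ideal.span {x₀}} = Nat.card (𝓞 K)ˣ := by
  refine (Nat.card_congr (Equiv.ofBijective
    (fun u : (𝓞 K)ˣ => (⟨x₀ * u, ?_⟩ : {x : 𝓞 K // Ideal.span {x} = Ideal.span {x₀}})) ⟨?_, ?_⟩)).symm
  · rw [Ideal.span_singleton_eq_span_singleton]
    exact ⟨u⁻¹, by simp⟩
  · intro u v h
    have h' : x₀ * u = x₀ * v := congrArg Subtype.val h
    exact Units.ext (mul_left_cancel₀ hx₀ h')
  · rintro ⟨x, hx⟩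
    obtain ⟨u, hu⟩ := (Ideal.span_singleton_eq_span_singleton.mp hx).symm
    exact ⟨u, Subtype.ext hu⟩

/-! ### The count -/

/-- `x ∈ 𝔞` iff `𝔞 ∣ (x)`, in which case `(x) = 𝔞 𝔟` for a unique `𝔟`. -/
private theorem exists_unique_eq_mul {𝔞 : Ideal (𝓞 K)} (h𝔞 : 𝔞 ≠ ⊥) {x : 𝓞 K} (hx : x ∈ 𝔞) :
    ∃! 𝔟 : Ideal (𝓞 K), Ideal.span {x} = 𝔞 * 𝔟 := by
  obtain ⟨𝔟, h𝔟⟩ : 𝔞 ∣ Ideal.span {x} := Ideal.dvd_iff_le.mpr ((Ideal.span_singleton_le_iff_mem _).mpr hx)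
  exact ⟨𝔟, h𝔟, fun 𝔟' h𝔟' => mul_left_cancel₀ h𝔞 (h𝔟'.symm.trans h𝔟)⟩

/-- **The class-representative count.**  Let `𝔞_c` (`c ∈ Cl(K)`) be nonzero integral ideals with
`[𝔞_c] = c`.  For `n ≥ 1`, `Σ_c #{x ∈ 𝔞_c : N((x)) = n·N𝔞_c} = #𝓞_K^× · #{𝔟 : N𝔟 = n}`: the map
`(c, x) ↦ 𝔟` with `(x) = 𝔞_c 𝔟` hits every `𝔟` of norm `n` (for `c = [𝔟]⁻¹` the ideal `𝔞_c𝔟` is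
principal), `c` is forced (`[𝔞_c] = [𝔟]⁻¹`), and the fibre over `𝔟` is the set of generators of
`𝔞_c 𝔟`. (Cox Thm. 7.7, (7.16); Zagier §8.) -/
theorem sum_natCard_norm_eq (hK : finrank ℚ K = 2) [IsTotallyComplex K]
    (𝔞 : ClassGroup (𝓞 K) → (Ideal (𝓞 K))⁰) (h𝔞 : ∀ c, ClassGroup.mk0 (𝔞 c) = c)
    {n : ℕ} (hn : n ≠ 0) :
    ∑ c : ClassGroup (𝓞 K),
        Nat.card {x : 𝓞 K // x ∈ (𝔞 c : Ideal (𝓞 K)) ∧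
          Ideal.absNorm (Ideal.span {x}) = n * Ideal.absNorm (𝔞 c : Ideal (𝓞 K))} =
      Nat.card (𝓞 K)ˣ * idealNormCount K n := by
  classical
  haveI : Finite (𝓞 K)ˣ := finite_units hK
  have h𝔞0 : ∀ c, (𝔞 c : Ideal (𝓞 K)) ≠ ⊥ := fun c => nonZeroDivisors.coe_ne_zero (𝔞 c)
  have h𝔞N : ∀ c, Ideal.absNorm (𝔞 c : Ideal (𝓞 K)) ≠ 0 := fun c => by
    rw [Ne, Ideal.absNorm_eq_zero_iff]; exact h𝔞0 c
  -- the domain as a subtype of a product, and the target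
  set D := {p : ClassGroup (𝓞 K) × 𝓞 K // p.2 ∈ (𝔞 p.1 : Ideal (𝓞 K)) ∧
    Ideal.absNorm (Ideal.span {p.2}) = n * Ideal.absNorm (𝔞 p.1 : Ideal (𝓞 K))} with hD
  set T := {J : Ideal (𝓞 K) // Ideal.absNorm J = n} with hT
  haveI : Finite T := (Ideal.finite_setOf_absNorm_eq (S := 𝓞 K) n).to_subtype
  letI : Fintype T := Fintype.ofFinite T
  -- the quotient map `(c, x) ↦ 𝔟`, `(x) = 𝔞_c 𝔟`
  have hquot : ∀ p : D, ∃! J : Ideal (𝓞 K), Ideal.span {p.1.2} = (𝔞 p.1.1 : Ideal (𝓞 K)) * J :=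
    fun p => exists_unique_eq_mul (h𝔞0 p.1.1) p.2.1
  have hquotN : ∀ p : D, ∀ J : Ideal (𝓞 K), Ideal.span {p.1.2} = (𝔞 p.1.1 : Ideal (𝓞 K)) * J →
      Ideal.absNorm J = n := by
    intro p J hJ
    have h := p.2.2
    rw [hJ, map_mul, mul_comm] at h
    exact mul_right_cancel₀ (h𝔞N p.1.1) h
  set f : D → T := fun p => ⟨(hquot p).choose, hquotN p _ (hquot p).choose_spec.1⟩ with hf
  have hf_spec : ∀ p : D, Ideal.span {p.1.2} = (𝔞 p.1.1 : Ideal (𝓞 K)) * (f p : Ideal (𝓞 K)) :=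
    fun p => (hquot p).choose_spec.1
  have hf_eq : ∀ (p : D) (J : Ideal (𝓞 K)), Ideal.span {p.1.2} = (𝔞 p.1.1 : Ideal (𝓞 K)) * J →
      (f p : Ideal (𝓞 K)) = J := fun p J hJ => ((hquot p).unique (hf_spec p) hJ)
  -- the class is forced: `[𝔞_c] = [𝔟]⁻¹`
  have hJ0 : ∀ J : T, (J : Ideal (𝓞 K)) ∈ (Ideal (𝓞 K))⁰ := fun J =>
    mem_nonZeroDivisors_of_ne_zero (by
      intro h; have := J.2; rw [h, Ideal.zero_eq_bot, Ideal.absNorm_bot] at this; exact hn this.symm)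
  set cl : T → ClassGroup (𝓞 K) := fun J => (ClassGroup.mk0 ⟨(J : Ideal (𝓞 K)), hJ0 J⟩)⁻¹ with hcl
  have hclass : ∀ p : D, p.1.1 = cl (f p) := by
    intro p
    rw [hcl]
    simp only
    rw [← h𝔞 p.1.1, ClassGroup.mk0_eq_mk0_inv_iff]
    refine ⟨p.1.2, ?_, (hf_spec p).symm⟩
    intro h0
    have := p.2.2
    rw [h0, Ideal.span_singleton_zero] at this
    simp only [Ideal.absNorm_bot] at this
    exact hn (by
      have h2 := mul_ne_zero hn (h𝔞N p.1.1)
      exact absurd this.symm h2 |> False.elim)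
  -- the principal ideal `𝔞_{cl J} · J` and the fibres
  have hprinc : ∀ J : T, ∃ x : 𝓞 K, x ≠ 0 ∧
      (𝔞 (cl J) : Ideal (𝓞 K)) * (J : Ideal (𝓞 K)) = Ideal.span {x} := by
    intro J
    have h := (ClassGroup.mk0_eq_mk0_inv_iff (I := 𝔞 (cl J)) (J := ⟨(J : Ideal (𝓞 K)), hJ0 J⟩)).mp
      (by rw [h𝔞])
    obtain ⟨x, hx, h'⟩ := h
    exact ⟨x, hx, h'⟩
  have hfibre : ∀ J : T, Nat.card {p : D // f p = J} = Nat.card (𝓞 K)ˣ := by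
    intro J
    obtain ⟨x₀, hx₀, hx₀J⟩ := hprinc J
    rw [← natCard_generators_eq hx₀]
    -- the map `q ↦ x`
    have hg : ∀ q : {p : D // f p = J}, Ideal.span {q.1.1.2} = Ideal.span {x₀} := by
      intro q
      have h1 := hf_spec q.1
      have h2 : ((f q.1 : T) : Ideal (𝓞 K)) = (J : Ideal (𝓞 K)) := congrArg Subtype.val q.2
      have h3 : q.1.1.1 = cl J := by rw [hclass q.1]; exact congrArg cl q.2
      rw [h2, h3, hx₀J] at h1
      exact h1
    refine Nat.card_congr (Equiv.ofBijective
      (fun q : {p : D // f p = J} => (⟨q.1.1.2, hg q⟩ : {x : 𝓞 K // Ideal.span {x} = Ideal.span {x₀}}))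
      ⟨?_, ?_⟩)
    · -- injective: the class is forced
      intro q q' hqq'
      have hx : q.1.1.2 = q'.1.1.2 := congrArg Subtype.val hqq'
      have hc : q.1.1.1 = q'.1.1.1 := by
        rw [hclass q.1, hclass q'.1]
        exact congrArg cl (q.2.trans q'.2.symm)
      apply Subtype.ext; apply Subtype.ext
      exact Prod.ext hc hx
    · -- surjective
      rintro ⟨y, hy⟩
      have hyJ : Ideal.span {y} = (𝔞 (cl J) : Ideal (𝓞 K)) * (J : Ideal (𝓞 K)) := hy.trans hx₀J.symm
      have hymem : y ∈ (𝔞 (cl J) : Ideal (𝓞 K)) :=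
        (Ideal.span_singleton_le_iff_mem _).mp (by rw [hyJ]; exact Ideal.mul_le_right)
      have hyN : Ideal.absNorm (Ideal.span {y}) = n * Ideal.absNorm (𝔞 (cl J) : Ideal (𝓞 K)) := by
        rw [hyJ, map_mul, J.2, mul_comm]
      let p : D := ⟨(cl J, y), hymem, hyN⟩
      have hfp : f p = J := Subtype.ext (hf_eq p _ hyJ)
      exact ⟨⟨p, hfp⟩, rfl⟩
  have hw0 : Nat.card (𝓞 K)ˣ ≠ 0 := Nat.card_pos.ne'
  haveI hfibfin : ∀ J : T, Finite {p : D // f p = J} := fun J =>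
    Nat.finite_of_card_ne_zero (by rw [hfibre J]; exact hw0)
  haveI : Finite D := by
    rw [(Equiv.sigmaFiberEquiv f).symm.finite_iff]; infer_instance
  haveI : ∀ c : ClassGroup (𝓞 K), Finite {x : 𝓞 K // x ∈ (𝔞 c : Ideal (𝓞 K)) ∧
      Ideal.absNorm (Ideal.span {x}) = n * Ideal.absNorm (𝔞 c : Ideal (𝓞 K))} := fun c =>
    Finite.of_injective (fun x => (⟨(c, x.1), x.2⟩ : D)) fun x x' h => by
      apply Subtype.ext
      have := congrArg (fun p : D => p.1.2) h
      exact this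
  -- count: `#D = Σ_J #fibre = #T · w`
  have hDcard : Nat.card D = Nat.card (𝓞 K)ˣ * idealNormCount K n := by
    rw [Nat.card_congr (Equiv.sigmaFiberEquiv f).symm, Nat.card_sigma]
    simp only [hfibre, Finset.sum_const, smul_eq_mul, Finset.card_univ]
    rw [idealNormCount, ← Nat.card_eq_fintype_card, mul_comm]
  -- and `#D = Σ_c #X_c`
  rw [← hDcard, hD, Nat.card_congr (Equiv.subtypeProdEquivSigmaSubtype
    (fun c (x : 𝓞 K) => x ∈ (𝔞 c : Ideal (𝓞 K)) ∧
      Ideal.absNorm (Ideal.span {x}) = n * Ideal.absNorm (𝔞 c : Ideal (𝓞 K)))), Nat.card_sigma]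

end Summit.BirchSwinnertonDyer.BirchSwinnertonDyer.Theorems.HeckeTheta

end
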